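import Summits.CriticalPhenomena.PercolationContinuityZ3.Theorems.PercNearOneGluingNoHeavyLowerTailNineTypeFlip

/-!
# Nine-type programme for `Q44b`: the filter certificate and the TWINS LEMMA

Support file for crux `stmt-CriticalPhenomena-4575` (master-family programme, quadratic four-point row `Q44b`,
GF(2)-rank line of `prim-bnk-1` gen 16–18 / `prim-l12-p6` gen 9–10), seat `prim-bnk-1` gen 18; memo
`run/shared/lean/prim/prim-l12/FROM-prim-bnk-1-gen18-KLEITMAN-SPLIT.md` §2.

Setting (as in `…NineTypeAnchor`, `…NineTypeFlip`): a finite ground type `α`, an UP-SET `𝔊` of goods, a typed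
configuration `𝒯` of bad points (types `θ ∈ {1,…,9}`, tables `hlOK`, `contPairs` of the anchor file and the
HH-table `hhOK` below).  The residual statement of the programme (conjecture K3 / R7 step, memo §2) says that for
a free point `t` (type `5` or `7`) whose H-row `[t ⊆ g]` is a GF(2)-combination of other H-rows in the right way,
the L-row `[tᶜ ⊆ g]` is NOT a combination of H-rows, i.e. there is no family `S ⊆ 𝒯` with
`#{s ∈ S : s ⊆ g} ≡ [tᶜ ⊆ g] (mod 2)` for every good `g`.

* `NineType.filter_certificate` — the simplest certificate for such a non-representation: if some GOOD `U ⊇ t`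
  is such that no member of `S` contains `Uᶜ`, then the parity relation above is impossible (double count of
  `Σ_{u ∈ 𝔊, U ⊆ u} #{s ∈ S : s ⊆ u}` with the toggling lemma `card_supersets_parity`).
* `NineType.twins_core`, `NineType.twins_no_cover`, **`NineType.twins_L_row_not_H_combination` (twins lemma)**:
  if a free point `t` and an anchored point `a` of type `8/9` are TWINS (`t ⊆ g ↔ a ⊆ g` for every good `g`, i.e.
  their H-rows coincide — the smallest H-circuit), then `t ∆ a` lies in every good, no bad point contains
  `(t ∪ a)ᶜ` (tables + CONT + COV), and hence, by the filter certificate with `U = t ∪ a`, the L-row of `t` is not a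
  GF(2)-combination of H-rows.  This is the circuit-size-2 case of conjecture K1 of the memo and settles, e.g., every
  configuration whose H-row matroid has a single circuit consisting of a twin pair.

Pure finite combinatorics; no named facts, no sorries, standard axioms.
-/

namespace Summit.CriticalPhenomena.PercolationContinuityZ3.Theorems

namespace NineType

open Finset

/-- HH-compatibility table of the nine `Q44b` bad types (`prim-l12-p6` gen 9 §2, table HH): `hhOK a b` iff the
heavy cells of types `a` and `b` join into `AC` and their light cells meet in `⊥`; then `t ∪ t'` is a good point for
distinct bad `t, t'` of types `a, b`.  Rows: `1→{2,4,5,9}`, `2→{1,3,5,8}`, `3→{2,9}`, `4→{1,8}`, `5→{1,2,8,9}`,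
`6→∅`, `7→{8,9}`, `8→{2,4,5,7}`, `9→{1,3,5,7}`. -/
def hhOK (a b : ℕ) : Bool :=
  (a == 1 && (b == 2 || b == 4 || b == 5 || b == 9)) || (a == 2 && (b == 1 || b == 3 || b == 5 || b == 8))
  || (a == 3 && (b == 2 || b == 9)) || (a == 4 && (b == 1 || b == 8))
  || (a == 5 && (b == 1 || b == 2 || b == 8 || b == 9)) || (a == 7 && (b == 8 || b == 9))
  || (a == 8 && (b == 2 || b == 4 || b == 5 || b == 7)) || (a == 9 && (b == 1 || b == 3 || b == 5 || b == 7))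

/-- Table fact for the twins lemma: if a type `s ∈ {1,…,9}` is HH-compatible neither with a free type
`t ∈ {5,7}` nor with an anchored type `a ∈ {8,9}`, then `hlOK s t` and `hlOK a s` both hold. -/
theorem table_twins : ∀ s : ℕ, 1 ≤ s → s ≤ 9 → ∀ t : ℕ, (t = 5 ∨ t = 7) → ∀ a : ℕ, (a = 8 ∨ a = 9) →
    hhOK s a = false → hhOK s t = false → hlOK s t = true ∧ hlOK a s = true := by
  intro s hs1 hs9 t ht a ha
  interval_cases s <;> rcases ht with rfl | rfl <;> rcases ha with rfl | rfl <;> decide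

/-- Table fact: a free type is HH-compatible with an anchored type `8/9`, and the pair is not in `contPairs`. -/
theorem table_twins_pair : ∀ t : ℕ, (t = 5 ∨ t = 7) → ∀ a : ℕ, (a = 8 ∨ a = 9) →
    hhOK t a = true ∧ (t, a) ∉ contPairs := by
  intro t ht a ha
  rcases ht with rfl | rfl <;> rcases ha with rfl | rfl <;> decide

variable {α : Type*} [DecidableEq α] [Fintype α]

/-- **Filter certificate.**  Let `𝔊` be an up-set, `U ∈ 𝔊` a good containing `t`, and `S` a family none of whose
members contains `Uᶜ`.  Then the parity relation `#{s ∈ S : s ⊆ g} ≡ [tᶜ ⊆ g]` cannot hold for every good `g`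
(the L-row of `t` is not the sum of the H-rows of `S`): summing it over the goods above `U` gives `0 = 1`.
[this work, memo §2/§4] -/
theorem filter_certificate (𝔊 : Finset (Finset α))
    (hG : ∀ g ∈ 𝔊, ∀ g' : Finset α, g ⊆ g' → g' ∈ 𝔊)
    (U : Finset α) (hU : U ∈ 𝔊) (t : Finset α) (ht : t ⊆ U)
    (S : Finset (Finset α)) (hS : ∀ s ∈ S, ¬ Uᶜ ⊆ s) :
    ¬ (∀ g ∈ 𝔊, ((#(S.filter (fun s => s ⊆ g)) : ℕ) : ZMod 2) = if tᶜ ⊆ g then 1 else 0) := by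
  intro hrel
  -- D := Σ_{u ∈ 𝔊, U ⊆ u} #{s ∈ S : s ⊆ u}; first evaluation: via the relation
  have h1 : ∑ u ∈ 𝔊.filter (fun u => U ⊆ u),
      ((#(S.filter (fun s => s ⊆ u)) : ℕ) : ZMod 2) = 1 := by
    calc ∑ u ∈ 𝔊.filter (fun u => U ⊆ u), ((#(S.filter (fun s => s ⊆ u)) : ℕ) : ZMod 2)
        = ∑ u ∈ 𝔊.filter (fun u => U ⊆ u), (if tᶜ ⊆ u then (1 : ZMod 2) else 0) := by
          refine Finset.sum_congr rfl fun u hu => ?_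
          exact hrel u (Finset.mem_filter.1 hu).1
      _ = ∑ u ∈ 𝔊, (if U ∪ tᶜ ⊆ u then (1 : ZMod 2) else 0) := by
          rw [Finset.sum_filter]
          refine Finset.sum_congr rfl fun u _ => ?_
          by_cases hUu : U ⊆ u
          · rw [if_pos hUu]
            by_cases htu : tᶜ ⊆ u
            · rw [if_pos htu, if_pos (Finset.union_subset hUu htu)]
            · rw [if_neg htu, if_neg (fun h => htu (subset_union_right.trans h))]
          · rw [if_neg hUu, if_neg (fun h => hUu (subset_union_left.trans h))]
      _ = ((#(𝔊.filter (fun u => U ∪ tᶜ ⊆ u)) : ℕ) : ZMod 2) :=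
          (card_filter_cast 𝔊 (fun u => U ∪ tᶜ ⊆ u)).symm
      _ = 1 := by
          rw [card_supersets_parity 𝔊 hG (U ∪ tᶜ) (hG U hU _ subset_union_left)]
          have huniv : U ∪ tᶜ = univ := by
            refine Finset.eq_univ_iff_forall.2 fun x => ?_
            by_cases hx : x ∈ t
            · exact Finset.mem_union.2 (Or.inl (ht hx))
            · exact Finset.mem_union.2 (Or.inr (Finset.mem_compl.2 hx))
          rw [if_pos huniv]
  -- second evaluation: swap the sums; every member of `S` contributes `[U ∪ s = univ] = 0`
  have h2 : ∑ u ∈ 𝔊.filter (fun u => U ⊆ u),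
      ((#(S.filter (fun s => s ⊆ u)) : ℕ) : ZMod 2) = 0 := by
    calc ∑ u ∈ 𝔊.filter (fun u => U ⊆ u), ((#(S.filter (fun s => s ⊆ u)) : ℕ) : ZMod 2)
        = ∑ u ∈ 𝔊.filter (fun u => U ⊆ u), ∑ s ∈ S, (if s ⊆ u then (1 : ZMod 2) else 0) := by
          refine Finset.sum_congr rfl fun u _ => ?_
          exact card_filter_cast S (fun s => s ⊆ u)
      _ = ∑ u ∈ 𝔊, ∑ s ∈ S, (if U ∪ s ⊆ u then (1 : ZMod 2) else 0) := by
          rw [Finset.sum_filter]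
          refine Finset.sum_congr rfl fun u _ => ?_
          by_cases hUu : U ⊆ u
          · rw [if_pos hUu]
            refine Finset.sum_congr rfl fun s _ => ?_
            by_cases hsu : s ⊆ u
            · rw [if_pos hsu, if_pos (Finset.union_subset hUu hsu)]
            · rw [if_neg hsu, if_neg (fun h => hsu (subset_union_right.trans h))]
          · rw [if_neg hUu]
            symm
            refine Finset.sum_eq_zero fun s _ => ?_
            rw [if_neg (fun h => hUu (subset_union_left.trans h))]
      _ = ∑ s ∈ S, ∑ u ∈ 𝔊, (if U ∪ s ⊆ u then (1 : ZMod 2) else 0) := Finset.sum_comm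
      _ = ∑ s ∈ S, ((#(𝔊.filter (fun u => U ∪ s ⊆ u)) : ℕ) : ZMod 2) := by
          refine Finset.sum_congr rfl fun s _ => ?_
          exact (card_filter_cast 𝔊 (fun u => U ∪ s ⊆ u)).symm
      _ = 0 := by
          refine Finset.sum_eq_zero fun s hs => ?_
          rw [card_supersets_parity 𝔊 hG (U ∪ s) (hG U hU _ subset_union_left)]
          have hc : ¬ U ∪ s = univ := by
            intro h
            have h' : sᶜ ⊆ U := (union_eq_univ_iff_compl_subset U s).1 h
            apply hS s hs
            intro x hx
            by_contra hxs
            exact (Finset.mem_compl.1 hx) (h' (Finset.mem_compl.2 hxs))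
          rw [if_neg hc]
  rw [h2] at h1
  exact zero_ne_one h1

omit [Fintype α] in
/-- Twins have their symmetric difference in every good: if `t ⊆ g ↔ a ⊆ g` for all goods `g` of an up-set,
then `t \ a ⊆ g` and `a \ t ⊆ g` for every good `g`. [this work] -/
theorem twins_core (𝔊 : Finset (Finset α))
    (hG : ∀ g ∈ 𝔊, ∀ g' : Finset α, g ⊆ g' → g' ∈ 𝔊)
    (t a : Finset α) (htwin : ∀ g ∈ 𝔊, t ⊆ g ↔ a ⊆ g) :
    ∀ g ∈ 𝔊, t \ a ⊆ g ∧ a \ t ⊆ g := by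
  intro g hg
  constructor
  · have h : t ⊆ g ∪ a := (htwin (g ∪ a) (hG g hg _ subset_union_left)).2 subset_union_right
    intro x hx
    rcases Finset.mem_sdiff.1 hx with ⟨hxt, hxa⟩
    rcases Finset.mem_union.1 (h hxt) with hxg | hxa'
    · exact hxg
    · exact absurd hxa' hxa
  · have h : a ⊆ g ∪ t := (htwin (g ∪ t) (hG g hg _ subset_union_left)).1 subset_union_right
    intro x hx
    rcases Finset.mem_sdiff.1 hx with ⟨hxa, hxt⟩
    rcases Finset.mem_union.1 (h hxa) with hxg | hxt'
    · exact hxg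
    · exact absurd hxt' hxt

omit [DecidableEq α] in
/-- If `(t ∪ a)ᶜ ⊆ s` then `s ∪ a ⊇ t` forces `s ∪ a = univ`. [folklore] -/
theorem union_eq_univ_of_compl_subset [DecidableEq α] (t a s u : Finset α)
    (hsub : (t ∪ a)ᶜ ⊆ s) (htu : t ⊆ s ∪ u) (hau : a ⊆ s ∪ u) : s ∪ u = univ := by
  refine Finset.eq_univ_iff_forall.2 fun x => ?_
  by_cases hx : x ∈ t ∪ a
  · rcases Finset.mem_union.1 hx with h | h
    · exact htu h
    · exact hau h
  · exact Finset.mem_union.2 (Or.inl (hsub (Finset.mem_compl.2 hx)))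

/-- **No bad point covers the complement of a twin pair.**  In a CONT/COV configuration with HL- and HH-forced
goods in the up-set `𝔊`: if a free point `t` (type `5`/`7`) and a point `a` of type `8`/`9` are twins, then no
point `s ∈ 𝒯` contains `(t ∪ a)ᶜ`.  Proof: `s ∪ a, s ∪ t ∉ 𝔊` (else `= univ` by the twin property and the
hypothesis, contradicting COV), so `s` is HH-compatible with neither; the tables then give the goods `s ∪ tᶜ`
and `a ∪ sᶜ`, both of which contain the core set `t \ a` (`twins_core`) — forcing `t \ a ⊆ s` and
`t \ a ⊆ sᶜ`, i.e. `t ⊆ a`, excluded by `contPairs`. [this work, memo §2] -/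
theorem twins_no_cover (𝒯 : Finset (Finset α)) (θ : Finset α → ℕ)
    (hθ : ∀ s ∈ 𝒯, 1 ≤ θ s ∧ θ s ≤ 9)
    (hcont : ∀ s ∈ 𝒯, ∀ s' ∈ 𝒯, s ⊆ s' → (θ s, θ s') ∈ contPairs)
    (hcov : ∀ s ∈ 𝒯, ∀ s' ∈ 𝒯, s ≠ s' → s ∪ s' ≠ univ)
    (𝔊 : Finset (Finset α)) (hG : ∀ g ∈ 𝔊, ∀ g' : Finset α, g ⊆ g' → g' ∈ 𝔊)
    (hHL : ∀ s ∈ 𝒯, ∀ s' ∈ 𝒯, hlOK (θ s) (θ s') = true → s ∪ s'ᶜ ∈ 𝔊)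
    (hHH : ∀ s ∈ 𝒯, ∀ s' ∈ 𝒯, s ≠ s' → hhOK (θ s) (θ s') = true → s ∪ s' ∈ 𝔊)
    (t : Finset α) (ht : t ∈ 𝒯) (ht57 : θ t = 5 ∨ θ t = 7)
    (a : Finset α) (ha : a ∈ 𝒯) (ha89 : θ a = 8 ∨ θ a = 9)
    (htwin : ∀ g ∈ 𝔊, t ⊆ g ↔ a ⊆ g) :
    ∀ s ∈ 𝒯, ¬ (t ∪ a)ᶜ ⊆ s := by
  intro s hs hsub
  have hpair := table_twins_pair (θ t) ht57 (θ a) ha89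
  have hta : t ≠ a := by
    intro h
    rcases ht57 with h5 | h7 <;> rcases ha89 with h8 | h9 <;> rw [h] at * <;> omega
  -- `t ∪ a ≠ univ`, hence `s ≠ t` and `s ≠ a`
  have htau : t ∪ a ≠ univ := hcov t ht a ha hta
  have hst : s ≠ t := by
    intro h
    apply htau
    exact union_eq_univ_of_compl_subset t a s a hsub
      (h ▸ (subset_union_left : s ⊆ s ∪ a)) subset_union_right |>.symm ▸ (by rw [h])
  have hsa : s ≠ a := by
    intro h
    apply htau
    have := union_eq_univ_of_compl_subset t a s t hsub subset_union_right
      (h ▸ (subset_union_left : s ⊆ s ∪ t))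
    rw [h, Finset.union_comm] at this
    exact this
  -- `s ∪ a ∉ 𝔊` and `s ∪ t ∉ 𝔊`
  have hsa_bad : s ∪ a ∉ 𝔊 := by
    intro hg
    have htg : t ⊆ s ∪ a := (htwin _ hg).2 subset_union_right
    exact hcov s hs a ha hsa (union_eq_univ_of_compl_subset t a s a hsub htg subset_union_right)
  have hst_bad : s ∪ t ∉ 𝔊 := by
    intro hg
    have hag : a ⊆ s ∪ t := (htwin _ hg).1 subset_union_right
    exact hcov s hs t ht hst (union_eq_univ_of_compl_subset t a s t hsub subset_union_right hag)
  have hh1 : hhOK (θ s) (θ a) = false := by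
    by_contra h
    exact hsa_bad (hHH s hs a ha hsa (Bool.not_eq_false _ |>.mp h))
  have hh2 : hhOK (θ s) (θ t) = false := by
    by_contra h
    exact hst_bad (hHH s hs t ht hst (Bool.not_eq_false _ |>.mp h))
  obtain ⟨hl1, hl2⟩ := table_twins (θ s) (hθ s hs).1 (hθ s hs).2 (θ t) ht57 (θ a) ha89 hh1 hh2
  -- the goods `s ∪ tᶜ` and `a ∪ sᶜ` contain the core set `t \ a`
  have hg1 : s ∪ tᶜ ∈ 𝔊 := hHL s hs t ht hl1
  have hg2 : a ∪ sᶜ ∈ 𝔊 := hHL a ha s hs hl2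
  have hc1 : t \ a ⊆ s ∪ tᶜ := (twins_core 𝔊 hG t a htwin _ hg1).1
  have hc2 : t \ a ⊆ a ∪ sᶜ := (twins_core 𝔊 hG t a htwin _ hg2).1
  have hsub_ta : t ⊆ a := by
    intro x hxt
    by_contra hxa
    have hx : x ∈ t \ a := Finset.mem_sdiff.2 ⟨hxt, hxa⟩
    have h1 : x ∈ s := by
      rcases Finset.mem_union.1 (hc1 hx) with h | h
      · exact h
      · exact absurd hxt (Finset.mem_compl.1 h)
    rcases Finset.mem_union.1 (hc2 hx) with h | h
    · exact hxa h
    · exact (Finset.mem_compl.1 h) h1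
  exact hpair.2 (hcont t ht a ha hsub_ta)

/-- **Twins lemma** (circuit-size-two case of conjecture K1, memo §2): under the hypotheses of
`twins_no_cover`, the L-row of the free twin `t` is not a GF(2)-combination of H-rows: no family `S ⊆ 𝒯`
satisfies `#{s ∈ S : s ⊆ g} ≡ [tᶜ ⊆ g] (mod 2)` for every good `g`.  (Filter certificate with the HH-good
`U = t ∪ a`.) [this work] -/
theorem twins_L_row_not_H_combination (𝒯 : Finset (Finset α)) (θ : Finset α → ℕ)
    (hθ : ∀ s ∈ 𝒯, 1 ≤ θ s ∧ θ s ≤ 9)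
    (hcont : ∀ s ∈ 𝒯, ∀ s' ∈ 𝒯, s ⊆ s' → (θ s, θ s') ∈ contPairs)
    (hcov : ∀ s ∈ 𝒯, ∀ s' ∈ 𝒯, s ≠ s' → s ∪ s' ≠ univ)
    (𝔊 : Finset (Finset α)) (hG : ∀ g ∈ 𝔊, ∀ g' : Finset α, g ⊆ g' → g' ∈ 𝔊)
    (hHL : ∀ s ∈ 𝒯, ∀ s' ∈ 𝒯, hlOK (θ s) (θ s') = true → s ∪ s'ᶜ ∈ 𝔊)
    (hHH : ∀ s ∈ 𝒯, ∀ s' ∈ 𝒯, s ≠ s' → hhOK (θ s) (θ s') = true → s ∪ s' ∈ 𝔊)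
    (t : Finset α) (ht : t ∈ 𝒯) (ht57 : θ t = 5 ∨ θ t = 7)
    (a : Finset α) (ha : a ∈ 𝒯) (ha89 : θ a = 8 ∨ θ a = 9)
    (htwin : ∀ g ∈ 𝔊, t ⊆ g ↔ a ⊆ g)
    (S : Finset (Finset α)) (hS : S ⊆ 𝒯) :
    ¬ (∀ g ∈ 𝔊, ((#(S.filter (fun s => s ⊆ g)) : ℕ) : ZMod 2) = if tᶜ ⊆ g then 1 else 0) := by
  have hta : t ≠ a := by
    intro h
    rcases ht57 with h5 | h7 <;> rcases ha89 with h8 | h9 <;> rw [h] at * <;> omega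
  have hU : t ∪ a ∈ 𝔊 := hHH t ht a ha hta (table_twins_pair (θ t) ht57 (θ a) ha89).1
  exact filter_certificate 𝔊 hG (t ∪ a) hU t subset_union_left S
    (fun s hs => twins_no_cover 𝒯 θ hθ hcont hcov 𝔊 hG hHL hHH t ht ht57 a ha ha89 htwin s (hS hs))

end NineType

end Summit.CriticalPhenomena.PercolationContinuityZ3.Theorems
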